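import Summits.HodgeConjecture.HodgeConjecture.Theorems.F0LD2SameLabelLineClassAtPlace
import Summits.HodgeConjecture.HodgeConjecture.Theorems.F0LD2LineClassOfEquiv
import Summits.HodgeConjecture.HodgeConjecture.Theorems.F0P5PaydownStubRelabelUnit
import Literature.NumberTheory.Automorphic.Liu2021.CheckOfChiCompanionCharacter
import Literature.NumberTheory.Automorphic.Liu2021.LemD1AsPrintedIndexedNonVacuityAtPlace
import Literature.NumberTheory.Automorphic.Liu2021.LemD1RankTwoCMSameLabelLetter
import HarnessLib

/-!
# LD2 organ U₂′ pay-down, E₂ ASSEMBLED — «LINE-CLASS RIGIDITY AT A FIXED LABEL» for the unitary Shimura CURVES, in-house MODULO THE TWO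
# BOOKED LETTERS [Liu2021, Lem. D.1 (4)] (non-split, companion family) and [Liu2021, Lem. D.1 (1)] — the same two letters as ★ R2′

Cell `hodgecm-mathlib`, half A line LD2 (socket 27458 `stub_S1b_facts`; organ U₂′ `TwoTriples₂` of LD2-plan (g0)'s skeleton: this file pays its
SAME-λ half = organ L₂ `LineClassRigidity₂` of the LD2-p01 telescopes ∕ hypothesis `hE` of ★ `F0LD2LineClassOfEquiv.lineClassRigidity₂_of_equivForces`)
and line LD1 ((P♯) line pin); seat LD2-p01 (g0), 2026-09-02.  THEOREMS ONLY; `--supports stmt-HodgeConjecture-24832`.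

WHAT.
* §1 `chi_eq_of_equiv_carriers₂` — an equivariant equivalence of NON-ZERO carriers `ω(λ, ε_a, χ)_f ≃ ω(λ, ε_{a′}, χ′)_f` forces `χ = χ′`: the centre
  `U(1)(𝔸_{L⁺,f})` acts by `χ` resp. `χ′` (★ `rhoVAtLine_finAdelicCenter`).  In-house, no letter.
* §2 `locF_apply_eq_of_split₂` — at a SPLIT place every unit is a local norm (`d = δ²` is a square in `L⁺_v`: ★ `not_isField_localRing_of_split`,
  ★ `isField_localRing_of_not_isSquare`, ★ `quadraticNormSubgroup_eq_top_of_isSquare`), so `locF a v = locF a′ v` for all `a, a′`.  In-house.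
* §3 **`locF_eq_of_equiv_carriers₂ (h4) (h1)`** — E₂: in the registered frame of #74 ∕ G2 (`diag dV` of signature `(1,1)` at `ι`, definite elsewhere,
  `[L:ℚ] ≥ 4`), for a conjugate-symplectic WEIGHT-ONE `λ`: `Nontrivial (ω(λ, ε_a, χ)_f)` ∧ equivariant `ω(λ, ε_a, χ)_f ≃ₗ ω(λ, ε_{a′}, χ′)_f` ⇒
  `∀ v, locF a v = locF a′ v`.  Assembly: `χ = χ′` (§1); the companion label `λ′ = λᶜ·χ̌` (★ `IsConjugateSymplectic.exists_companion_galConj_mul_checkOfChi`);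
  the flipped line `b` (★ R1 `F0P5PaydownStubRelabelUnit.stub_arith_relabelUnit_holds`); split places §2; non-split places ★ stage B
  `F0LD2SameLabelLineClassAtPlace.locF_apply_eq_of_equiv_localTypes_nonsplit` on ★ stage A `F0LD2LocalTypesRankTwo.nonempty_equiv_localTypes₂`.
* §4 **`lineClassRigidity₂_of_letters (h4) (h1) : ‹LineClassRigidity₂›`** — the LD2-p01 organ L₂ («an irreducible `σ` embedding in
  `ω(λ,ε_a,χ)_f ∘ congr⁻¹` and in `ω(λ,ε_{a′},χ′)_f ∘ congr⁻¹` has `locF a = locF a′`») CLOSED MODULO `h4 : LemD1_4AsPrintedNonsplitCM₂`, `h1 : LemD1_1AsPrintedCM₂`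
  (★ `F0LD2LineClassOfEquiv.exists_linearEquiv_rhoVAtLine_of_injective_pair` ∘ §3).
PRINT: [Liu2021, Thm. 4.18 (2)] «mutually non-isomorphic» with its proof «Statement (2) follows from Lemma D.1» (l. 2270), here at `n = 2` through
Lem. D.1 (4)+(1) — the `ε`-component at a fixed `μ`.

HONEST LABEL.  HC_CM is proved only modulo the 7 printed citations (2 remaining: hLiu418 = stmt-HodgeConjecture-24832, h413 =
stmt-HodgeConjecture-24833) until rung 0 closes; this file discharges none of them; it retires no letter by itself (its two hypotheses ARE the
booked rows ★ p832219), it makes the same-λ half of U₂′ kernel-checked modulo them.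

## References
* [Liu2021] Y. Liu, Camb. J. Math. 9 (2021) = arXiv:2102.11518: Thm. 4.18 (2) (p. 47) and proof (p. 48, l. 2270); App. D §D.1, Lem. D.1 (1), (4)
  (p. 125–126); Def. 4.1, 4.11, 4.12; Rem. 4.4.
* [Omeara1963] O. T. O'Meara, *Introduction to Quadratic Forms*, §63B, §71 Thm. 71:19.
-/

set_option autoImplicit false
set_option linter.dupNamespace false

noncomputable section

open scoped Matrix Kronecker RestrictedProduct NumberField TensorProduct ComplexOrder
open NumberField IsDedekindDomain Filter MeasureTheory
open Literature.NumberTheory Literature.NumberTheory.Automorphic Literature.NumberTheory.Automorphic.UnitaryGroup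
open Literature.NumberTheory.Automorphic.UnitaryCurveForms
open Literature.NumberTheory.GelbartRogawski1991 Literature.NumberTheory.GelbartRogawski1991.UnitaryDualPair
open Literature.NumberTheory.GelbartRogawski1991.UnitaryDualPair.WeilCoinv
open Literature.NumberTheory.GelbartRogawski1991.UnitaryDualPair.LocalSplitting
open Literature.NumberTheory.GelbartRogawski1991.GRConstruction
open Literature.NumberTheory.Weil1964 Literature.RepresentationTheory
open Literature.RepresentationTheory.HeisenbergGroup
open Literature.NumberTheory.GaloisRepresentations Literature.RepresentationTheory.HarrisKudlaSweet1996
open Literature.NumberTheory.Automorphic.IdeleClassGroup Literature.RepresentationTheory.Liu2021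
open Literature.NumberTheory.Automorphic.Liu2021 Literature.NumberTheory.Automorphic.Liu2021.Def411WeilCarriers
open Literature.NumberTheory.Automorphic.Liu2021.Def411WeilCarriersDoubling
open Literature.NumberTheory.Automorphic.Liu2021.LemD1RankTwoCMLetters
open Literature.NumberTheory.Automorphic.Liu2021.RemD5
open Summit.HodgeConjecture.HodgeConjecture.Cruxes.HLiu418.F0P5CurveThetaCompanionRelabelOfLocalFactors
open Summit.HodgeConjecture.HodgeConjecture.Cruxes.HLiu418.F0LD2LocalTypesRankTwo
open Summit.HodgeConjecture.HodgeConjecture.Cruxes.HLiu418.F0LD2SameLabelLineClassAtPlace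
open Summit.HodgeConjecture.HodgeConjecture.Cruxes.HLiu418.F0LD2LineClassOfEquiv
open Summit.HodgeConjecture.HodgeConjecture.Cruxes.HLiu418.F0P5PaydownStubRelabelUnit

namespace Summit.HodgeConjecture.HodgeConjecture.Cruxes.HLiu418.F0LD2SameLabelLineClass

variable (L : Type) [Field L] [NumberField L] [IsCMField L]
  {n' : ℕ} (e₁ : Fin 2 × Fin 1 ≃ Fin n') (dV : Fin 2 → L) (hdV : ∀ i, IsCMField.complexConj L (dV i) = dV i) (hdV0 : ∀ i, dV i ≠ 0)
  (lam : Literature.NumberTheory.Automorphic.IdeleClassGroup L →ₜ* Circle) (hlam : IsConjugateSymplectic L lam)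
  (a a' : (Fp L)ˣ) (χ χ' : Chi (Fp L) L (IsCMField.complexConj L))

/-! ## §1 The centre reads off `χ`: equivalent non-zero carriers have the same Step-3 character -/

set_option maxHeartbeats 800000 in -- the CM θ-carrier terms (not minimised)
/-- **`χ = χ′` from an equivariant equivalence of NON-ZERO carriers** `ω(λ, ε_a, χ)_f ≃ ω(λ, ε_{a′}, χ′)_f`: the centre `U(1)(𝔸_{L⁺,f})` acts through
`χ`, resp. `χ′` (★ `rhoVAtLine_finAdelicCenter`), and a non-zero vector separates the two scalars. [cite: Liu2021, App. D §D.1 Step 3 (l. 5221); Def. 4.11 (l. 2092–2096)] -/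
theorem chi_eq_of_equiv_carriers₂
    [Nontrivial (omegaAtLine (Fp L) L (IsCMField.complexConj L) 2 e₁ (Matrix.diagonal dV) (complexConj_imagUnit L) (imagUnit_ne_zero L) (imagUnit_mul_self L) (realDiagonal_isSymm L dV hdV) (isUnit_det_realDiagonal L dV hdV hdV0) (realDiagonal_map L dV hdV).symm (fun b => isCompatible_chiSplittingLine L e₁ dV hdV hdV0 (toHeckeCharacter L lam) (isUnitary_toHeckeCharacter L lam) ((isOscillatorChar_toHeckeCharacter_iff lam).mpr hlam) (TW (Fp L) b) (isSymm_TW (Fp L) b) (isUnit_det_TW (Fp L) b) (JW (Fp L) L b) (JW_eq (Fp L) L b)) a χ)]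
    (hst : ∃ f : (omegaAtLine (Fp L) L (IsCMField.complexConj L) 2 e₁ (Matrix.diagonal dV) (complexConj_imagUnit L) (imagUnit_ne_zero L) (imagUnit_mul_self L) (realDiagonal_isSymm L dV hdV) (isUnit_det_realDiagonal L dV hdV hdV0) (realDiagonal_map L dV hdV).symm (fun b => isCompatible_chiSplittingLine L e₁ dV hdV hdV0 (toHeckeCharacter L lam) (isUnitary_toHeckeCharacter L lam) ((isOscillatorChar_toHeckeCharacter_iff lam).mpr hlam) (TW (Fp L) b) (isSymm_TW (Fp L) b) (isUnit_det_TW (Fp L) b) (JW (Fp L) L b) (JW_eq (Fp L) L b)) a χ) ≃ₗ[ℂ] (omegaAtLine (Fp L) L (IsCMField.complexConj L) 2 e₁ (Matrix.diagonal dV) (complexConj_imagUnit L) (imagUnit_ne_zero L) (imagUnit_mul_self L) (realDiagonal_isSymm L dV hdV) (isUnit_det_realDiagonal L dV hdV hdV0) (realDiagonal_map L dV hdV).symm (fun b => isCompatible_chiSplittingLine L e₁ dV hdV hdV0 (toHeckeCharacter L lam) (isUnitary_toHeckeCharacter L lam) ((isOscillatorChar_toHeckeCharacter_iff lam).mpr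 hlam) (TW (Fp L) b) (isSymm_TW (Fp L) b) (isUnit_det_TW (Fp L) b) (JW (Fp L) L b) (JW_eq (Fp L) L b)) a' χ'),
      ∀ (k : finAdelic (Fp L) L (IsCMField.complexConj L) 2 (Matrix.diagonal dV)) x,
        f ((rhoVAtLine (Fp L) L (IsCMField.complexConj L) 2 e₁ (Matrix.diagonal dV) (complexConj_imagUnit L) (imagUnit_ne_zero L) (imagUnit_mul_self L) (realDiagonal_isSymm L dV hdV) (isUnit_det_realDiagonal L dV hdV hdV0) (realDiagonal_map L dV hdV).symm (fun b => isCompatible_chiSplittingLine L e₁ dV hdV hdV0 (toHeckeCharacter L lam) (isUnitary_toHeckeCharacter L lam) ((isOscillatorChar_toHeckeCharacter_iff lam).mpr hlam) (TW (Fp L) b) (isSymm_TW (Fp L) b) (isUnit_det_TW (Fp L) b) (JW (Fp L) L b) (JW_eq (Fp L) L b)) a χ) k x) = (rhoVAtLine (Fp L) L (IsCMField.complexConj L) 2 e₁ (Matrix.diagonal dV) (complexConj_imagUnit L) (imagUnit_ne_zero L) (imagUnit_mul_self L) (realDiagonal_isSymm L dV hdV) (isUnit_det_realDiagonal L dV hdV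 hdV0) (realDiagonal_map L dV hdV).symm (fun b => isCompatible_chiSplittingLine L e₁ dV hdV hdV0 (toHeckeCharacter L lam) (isUnitary_toHeckeCharacter L lam) ((isOscillatorChar_toHeckeCharacter_iff lam).mpr hlam) (TW (Fp L) b) (isSymm_TW (Fp L) b) (isUnit_det_TW (Fp L) b) (JW (Fp L) L b) (JW_eq (Fp L) L b)) a' χ') k (f x)) :
    χ = χ' := by
  obtain ⟨x, hx⟩ := exists_ne (0 : (omegaAtLine (Fp L) L (IsCMField.complexConj L) 2 e₁ (Matrix.diagonal dV) (complexConj_imagUnit L) (imagUnit_ne_zero L) (imagUnit_mul_self L) (realDiagonal_isSymm L dV hdV) (isUnit_det_realDiagonal L dV hdV hdV0) (realDiagonal_map L dV hdV).symm (fun b => isCompatible_chiSplittingLine L e₁ dV hdV hdV0 (toHeckeCharacter L lam) (isUnitary_toHeckeCharacter L lam) ((isOscillatorChar_toHeckeCharacter_iff lam).mpr hlam) (TW (Fp L) b) (isSymm_TW (Fp L) b) (isUnit_det_TW (Fp L) b) (JW (Fp L) L b) (JW_eq (Fp L) L b)) a χ))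
  refine hst.elim fun f hf => Subtype.ext (MonoidHom.ext fun u => Units.ext ?_)
  have h := hf (UnitaryGroup.finAdelicCenter (Fp L) L (IsCMField.complexConj L) 2 (Matrix.diagonal dV) u) x
  rw [rhoVAtLine_finAdelicCenter, rhoVAtLine_finAdelicCenter, map_smul] at h
  have hfx : f x ≠ 0 := fun h0 => hx (f.injective (h0.trans (map_zero f).symm))
  exact smul_left_injective ℂ hfx h

/-! ## §2 Split places: all lines have the same local class -/

/-- **At a SPLIT finite place of `L⁺` (in `L`) every unit of `L⁺_v` is a local norm**: `locF a v = locF a′ v` for all lines `a, a′` (`d = δ²` is a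
square in `L⁺_v` since `L ⊗ L⁺_v` is not a field — ★ `not_isField_localRing_of_split`, ★ `isField_localRing_of_not_isSquare` — and then the norm
subgroup is everything, ★ `quadraticNormSubgroup_eq_top_of_isSquare`). [cite: Omeara1963, §63B] [cite: Liu2021, Def. 4.12 (l. 2105)] -/
theorem locF_apply_eq_of_split₂ (v : HeightOneSpectrum (𝓞 (Fp L))) (w : UnitaryGroup.PlacesOver L v)
    (hw : IsCMField.complexConj L • (w : HeightOneSpectrum (𝓞 L)) ≠ w) :
    locF (Fp L) (imagUnitSq L) a v = locF (Fp L) (imagUnitSq L) a' v := by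
  have hsq : IsSquare (algebraMap (Fp L) (v.adicCompletion (Fp L)) (imagUnitSq L)) := by
    by_contra hns
    exact LemD1IndexedNonVacuityAtPlace.not_isField_localRing_of_split L v (IsCMField.complexConj L) w hw
      (isField_localRing_of_not_isSquare L v (IsCMField.complexConj L) (complexConj_imagUnit L) (imagUnit_ne_zero L)
        (imagUnit_mul_self L) hns)
  have hd0' : imagUnitSq L ≠ 0 := fun h => by
    have h' := imagUnit_mul_self L
    rw [h, map_zero, mul_self_eq_zero] at h'
    exact imagUnit_ne_zero L h'
  have hd0 : algebraMap (Fp L) (v.adicCompletion (Fp L)) (imagUnitSq L) ≠ 0 := (map_ne_zero _).2 hd0'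
  haveI : NeZero (2 : v.adicCompletion (Fp L)) := ⟨two_ne_zero⟩
  rw [locF_apply, locF_apply, QuotientGroup.eq, QuadraticForms.quadraticNormSubgroup_eq_top_of_isSquare hsq hd0]
  exact Subgroup.mem_top _

/-! ## §3 E₂ — line-class rigidity at a fixed conjugate-symplectic weight-one label, modulo the two booked letters -/

set_option maxHeartbeats 800000 in -- the CM θ-package terms (stage A∕B statements instantiated; not minimised)
/-- **E₂ (the `hE` of ★ `lineClassRigidity₂_of_equivForces`, with the frame and weight binders it needs): for the registered frame of #74 ∕ G2
and a conjugate-symplectic weight-one `λ`, an equivariant equivalence of NON-ZERO carriers `ω(λ, ε_a, χ)_f ≃ ω(λ, ε_{a′}, χ′)_f` forces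
`locF a v = locF a′ v` at EVERY finite place** — modulo the booked letters `h4` = [Liu2021, Lem. D.1 (4)] (non-split, companion family) and
`h1` = [Liu2021, Lem. D.1 (1)].  [cite: Liu2021, Thm. 4.18 (2) p. 47 and proof l. 2270; App. D Lem. D.1 (1), (4) p. 125–126; Def. 4.12; Rem. 4.4]
[cite: Omeara1963, §71 Thm. 71:19] -/
theorem locF_eq_of_equiv_carriers₂ (ι : L →+* ℂ)
    (hsig₁ : ∃ T : GL (Fin 2) ℂ, formCongr (starRingEnd ℂ) T ((Matrix.diagonal dV).map ι) = Matrix.diagonal ![(1 : ℂ), -1])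
    (hsig₂ : ∀ τ' : L →+* ℂ, InfinitePlace.mk τ' ≠ InfinitePlace.mk ι → ((Matrix.diagonal dV).map τ').PosDef)
    (hL : 4 ≤ Module.finrank ℚ L) (hw : HasWeight L lam 1)
    (h4 : LemD1_4AsPrintedNonsplitCM₂) (h1 : LemD1_1AsPrintedCM₂)
    [Nontrivial (omegaAtLine (Fp L) L (IsCMField.complexConj L) 2 e₁ (Matrix.diagonal dV) (complexConj_imagUnit L) (imagUnit_ne_zero L) (imagUnit_mul_self L) (realDiagonal_isSymm L dV hdV) (isUnit_det_realDiagonal L dV hdV hdV0) (realDiagonal_map L dV hdV).symm (fun b => isCompatible_chiSplittingLine L e₁ dV hdV hdV0 (toHeckeCharacter L lam) (isUnitary_toHeckeCharacter L lam) ((isOscillatorChar_toHeckeCharacter_iff lam).mpr hlam) (TW (Fp L) b) (isSymm_TW (Fp L) b) (isUnit_det_TW (Fp L) b) (JW (Fp L) L b) (JW_eq (Fp L) L b)) a χ)]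
    (hst : ∃ f : (omegaAtLine (Fp L) L (IsCMField.complexConj L) 2 e₁ (Matrix.diagonal dV) (complexConj_imagUnit L) (imagUnit_ne_zero L) (imagUnit_mul_self L) (realDiagonal_isSymm L dV hdV) (isUnit_det_realDiagonal L dV hdV hdV0) (realDiagonal_map L dV hdV).symm (fun b => isCompatible_chiSplittingLine L e₁ dV hdV hdV0 (toHeckeCharacter L lam) (isUnitary_toHeckeCharacter L lam) ((isOscillatorChar_toHeckeCharacter_iff lam).mpr hlam) (TW (Fp L) b) (isSymm_TW (Fp L) b) (isUnit_det_TW (Fp L) b) (JW (Fp L) L b) (JW_eq (Fp L) L b)) a χ) ≃ₗ[ℂ] (omegaAtLine (Fp L) L (IsCMField.complexConj L) 2 e₁ (Matrix.diagonal dV) (complexConj_imagUnit L) (imagUnit_ne_zero L) (imagUnit_mul_self L) (realDiagonal_isSymm L dV hdV) (isUnit_det_realDiagonal L dV hdV hdV0) (realDiagonal_map L dV hdV).symm (fun b => isCompatible_chiSplittingLine L e₁ dV hdV hdV0 (toHeckeCharacter L lam) (isUnitary_toHeckeCharacter L lam) ((isOscillatorChar_toHeckeCharacter_iff lam).mpr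 hlam) (TW (Fp L) b) (isSymm_TW (Fp L) b) (isUnit_det_TW (Fp L) b) (JW (Fp L) L b) (JW_eq (Fp L) L b)) a' χ'),
      ∀ (k : finAdelic (Fp L) L (IsCMField.complexConj L) 2 (Matrix.diagonal dV)) x,
        f ((rhoVAtLine (Fp L) L (IsCMField.complexConj L) 2 e₁ (Matrix.diagonal dV) (complexConj_imagUnit L) (imagUnit_ne_zero L) (imagUnit_mul_self L) (realDiagonal_isSymm L dV hdV) (isUnit_det_realDiagonal L dV hdV hdV0) (realDiagonal_map L dV hdV).symm (fun b => isCompatible_chiSplittingLine L e₁ dV hdV hdV0 (toHeckeCharacter L lam) (isUnitary_toHeckeCharacter L lam) ((isOscillatorChar_toHeckeCharacter_iff lam).mpr hlam) (TW (Fp L) b) (isSymm_TW (Fp L) b) (isUnit_det_TW (Fp L) b) (JW (Fp L) L b) (JW_eq (Fp L) L b)) a χ) k x) = (rhoVAtLine (Fp L) L (IsCMField.complexConj L) 2 e₁ (Matrix.diagonal dV) (complexConj_imagUnit L) (imagUnit_ne_zero L) (imagUnit_mul_self L) (realDiagonal_isSymm L dV hdV) (isUnit_det_realDiagonal L dV hdV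 hdV0) (realDiagonal_map L dV hdV).symm (fun b => isCompatible_chiSplittingLine L e₁ dV hdV hdV0 (toHeckeCharacter L lam) (isUnitary_toHeckeCharacter L lam) ((isOscillatorChar_toHeckeCharacter_iff lam).mpr hlam) (TW (Fp L) b) (isSymm_TW (Fp L) b) (isUnit_det_TW (Fp L) b) (JW (Fp L) L b) (JW_eq (Fp L) L b)) a' χ') k (f x))
    (v : HeightOneSpectrum (𝓞 (Fp L))) :
    locF (Fp L) (imagUnitSq L) a v = locF (Fp L) (imagUnitSq L) a' v := by
  -- `χ′ = χ`
  have hχ : χ = χ' := chi_eq_of_equiv_carriers₂ L e₁ dV hdV hdV0 lam hlam a a' χ χ' hst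
  subst hχ
  -- the companion label `λ′ = λᶜ·χ̌` and the relabelling unit `b` (flipped exactly on the anisotropic set)
  have hcc : IsCMField.complexConj L * IsCMField.complexConj L = 1 := by
    ext y
    exact IsCMField.complexConj_apply_apply L y
  obtain ⟨lam', hH, hlam', -, -⟩ := hlam.exists_companion_galConj_mul_checkOfChi hcc χ hw
  have hJh : ((Matrix.diagonal dV).map (IsCMField.complexConj L))ᵀ = Matrix.diagonal dV := by
    rw [Matrix.diagonal_map (map_zero _), Matrix.diagonal_transpose]
    exact congrArg Matrix.diagonal (funext hdV)
  have hJdet : (Matrix.diagonal dV).det ≠ 0 := by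
    rw [Matrix.det_diagonal]
    exact Finset.prod_ne_zero_iff.2 fun i _ => hdV0 i
  obtain ⟨b, hb⟩ := stub_arith_relabelUnit_holds L ι dV hdV hdV0 hsig₁ hsig₂ hL a
  haveI : Nontrivial (omegaAtLine (Fp L) L (IsCMField.complexConj L) 2 e₁ (Matrix.diagonal dV) (complexConj_imagUnit L) (imagUnit_ne_zero L) (imagUnit_mul_self L) (realDiagonal_isSymm L dV hdV) (isUnit_det_realDiagonal L dV hdV hdV0) (realDiagonal_map L dV hdV).symm (fun b => isCompatible_chiSplittingLine L e₁ dV hdV hdV0 (toHeckeCharacter L lam) (isUnitary_toHeckeCharacter L lam) ((isOscillatorChar_toHeckeCharacter_iff lam).mpr hlam) (TW (Fp L) b) (isSymm_TW (Fp L) b) (isUnit_det_TW (Fp L) b) (JW (Fp L) L b) (JW_eq (Fp L) L b)) a' χ) := hst.elim fun f _ => f.symm.toEquiv.nontrivial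
  by_cases hsplit : ∃ w : UnitaryGroup.PlacesOver L v, IsCMField.complexConj L • (w : HeightOneSpectrum (𝓞 L)) ≠ w
  · obtain ⟨w, hw'⟩ := hsplit
    exact locF_apply_eq_of_split₂ L a a' v w hw'
  · push Not at hsplit
    exact locF_apply_eq_of_equiv_localTypes_nonsplit L e₁ dV hdV hdV0 lam hlam a a' χ lam' v hcc hlam' hH hJh hJdet b (hb hJh hJdet v)
      hsplit h4 h1 (nonempty_equiv_localTypes₂ L e₁ dV hdV hdV0 lam hlam a a' χ χ v hst)

/-! ## §4 The organ L₂ `LineClassRigidity₂` CLOSED MODULO the two booked letters -/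

set_option maxHeartbeats 800000 in -- the CM θ-carrier terms (not minimised)
/-- **L₂ `LineClassRigidity₂` (LD2-p01 telescopes, = the same-λ half of U₂′ `TwoTriples₂`) MODULO `h4`, `h1`**: in G2's frame, an irreducible smooth `σ`
with injective `j : σ → ω(λ,ε_a,χ)_f ∘ congr⁻¹` and `j′ : σ → ω(λ,ε_{a′},χ′)_f ∘ congr⁻¹` has `locF a v = locF a′ v` at every finite `v` — ★
`exists_linearEquiv_rhoVAtLine_of_injective_pair` + §3.  The conclusion is the body of `LineClassRigidity₂` ∕ of ★ `lineClassRigidity₂_of_equivForces`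
token for token. [cite: Liu2021, Thm. 4.18 (2) p. 47 and proof l. 2270; App. D Lem. D.1 (1), (4) p. 125–126; Def. 4.11, 4.12] -/
theorem lineClassRigidity₂_of_letters (h4 : LemD1_4AsPrintedNonsplitCM₂) (h1 : LemD1_1AsPrintedCM₂) :
  ∀ (L : Type) [Field L] [NumberField L] [IsCMField L] (ι : L →+* ℂ) (H : Matrix (Fin 2) (Fin 2) L)
        (dV : Fin 2 → L) (hdV : ∀ i, IsCMField.complexConj L (dV i) = dV i) (hdV0 : ∀ i, dV i ≠ 0)
        (t : L) (ht : t ≠ 0) (g : GL (Fin 2) L)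
        (hg : formCongr ((IsCMField.complexConj L : L ≃ₐ[↥(maximalRealSubfield L)] L) : L →+* L) g (t • H) = Matrix.diagonal dV),
        (∃ T : GL (Fin 2) ℂ, formCongr (starRingEnd ℂ) T ((Matrix.diagonal dV).map ι) = Matrix.diagonal ![(1 : ℂ), -1]) →
        (∀ τ' : L →+* ℂ, InfinitePlace.mk τ' ≠ InfinitePlace.mk ι → ((Matrix.diagonal dV).map τ').PosDef) →
        4 ≤ Module.finrank ℚ L →
        ∀ (𝔣 : ConeFrame L H (cmPlace L ι))
          (μ : Measure (adelicGroupData (↥(maximalRealSubfield L)) L (IsCMField.complexConj L) 2 H).automorphicQuotient)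
          [(adelicGroupData (↥(maximalRealSubfield L)) L (IsCMField.complexConj L) 2 H).IsAutomorphicMeasure μ]
          {n' : ℕ} (e₁ : Fin 2 × Fin 1 ≃ Fin n')
          (lam : Literature.NumberTheory.Automorphic.IdeleClassGroup L →ₜ* Circle) (hlam : IsConjugateSymplectic L lam), HasWeight L lam 1 →
        ∀ (a a' : (↥(maximalRealSubfield L))ˣ) (χ χ' : Chi (↥(maximalRealSubfield L)) L (IsCMField.complexConj L))
          (W : Type) [AddCommGroup W] [Module ℂ W]
          (σ : Representation ℂ (finAdelic (↥(maximalRealSubfield L)) L (IsCMField.complexConj L) 2 H) W),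
          σ.IsIrreducible → σ.IsSmooth →
        ∀ j : σ.IntertwiningMap
            ((rhoVAtLine (↥(maximalRealSubfield L)) L (IsCMField.complexConj L) 2 e₁ (Matrix.diagonal dV)
                (complexConj_imagUnit L) (imagUnit_ne_zero L) (imagUnit_mul_self L) (realDiagonal_isSymm L dV hdV)
                (isUnit_det_realDiagonal L dV hdV hdV0) (realDiagonal_map L dV hdV).symm
                (fun a => isCompatible_chiSplittingLine L e₁ dV hdV hdV0 (toHeckeCharacter L lam)
                  (isUnitary_toHeckeCharacter L lam) ((isOscillatorChar_toHeckeCharacter_iff lam).mpr hlam)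
                  (TW (↥(maximalRealSubfield L)) a) (isSymm_TW (↥(maximalRealSubfield L)) a)
                  (isUnit_det_TW (↥(maximalRealSubfield L)) a) (JW (↥(maximalRealSubfield L)) L a)
                  (JW_eq (↥(maximalRealSubfield L)) L a)) a χ).comp
              (finAdelicCongr (↥(maximalRealSubfield L)) L (IsCMField.complexConj L) g ht hg).symm.toMonoidHom),
          Function.Injective j →
        ∀ j' : σ.IntertwiningMap
            ((rhoVAtLine (↥(maximalRealSubfield L)) L (IsCMField.complexConj L) 2 e₁ (Matrix.diagonal dV)
                (complexConj_imagUnit L) (imagUnit_ne_zero L) (imagUnit_mul_self L) (realDiagonal_isSymm L dV hdV)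
                (isUnit_det_realDiagonal L dV hdV hdV0) (realDiagonal_map L dV hdV).symm
                (fun a => isCompatible_chiSplittingLine L e₁ dV hdV hdV0 (toHeckeCharacter L lam)
                  (isUnitary_toHeckeCharacter L lam) ((isOscillatorChar_toHeckeCharacter_iff lam).mpr hlam)
                  (TW (↥(maximalRealSubfield L)) a) (isSymm_TW (↥(maximalRealSubfield L)) a)
                  (isUnit_det_TW (↥(maximalRealSubfield L)) a) (JW (↥(maximalRealSubfield L)) L a)
                  (JW_eq (↥(maximalRealSubfield L)) L a)) a' χ').comp
              (finAdelicCongr (↥(maximalRealSubfield L)) L (IsCMField.complexConj L) g ht hg).symm.toMonoidHom),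
          Function.Injective j' →
        ∀ v : HeightOneSpectrum (𝓞 ↥(maximalRealSubfield L)),
          locF (↥(maximalRealSubfield L)) (imagUnitSq L) a v = locF (↥(maximalRealSubfield L)) (imagUnitSq L) a' v := by
  intro L _ _ _ ι H dV hdV hdV0 t ht g hg hsig₁ hsig₂ hL 𝔣 μ _ n' e₁ lam hlam hw a a' χ χ' W _ _ σ hirr _ j hj j' hj' v
  obtain ⟨hnt, hst⟩ := exists_linearEquiv_rhoVAtLine_of_injective_pair L H dV hdV hdV0 t ht g hg e₁ lam hlam a a' χ χ' σ hirr
    j hj j' hj'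
  haveI := hnt
  exact locF_eq_of_equiv_carriers₂ L e₁ dV hdV hdV0 lam hlam a a' χ χ' ι hsig₁ hsig₂ hL hw h4 h1 hst v

/-! ## §5 (EDITION 2, ruling «U₂″-TRIM» = T2) E₂ and L₂ modulo the ONE letter «R₂» ★ `LemD1_4SameLabelNonsplitCM₂` (replaces `h4` + `h1`; the frame
binders `ι`, signatures, `4 ≤ [L:ℚ]` of §3 are no longer used: the relabelling unit R1 is not needed) -/

set_option maxHeartbeats 800000 in -- the CM θ-package terms (stage A statements instantiated; not minimised)
/-- **E₂′ — E₂ MODULO «R₂» ONLY**: for a conjugate-symplectic weight-one `λ`, an equivariant equivalence of NON-ZERO carriers `ω(λ, ε_a, χ)_f ≃ ω(λ, ε_{a′}, χ′)_f`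
forces `locF a v = locF a′ v` at every finite `v`: `χ′ = χ` (§1); split `v` (§2, no letter); non-split `v`: «R₂» fed with the local non-vanishing of
`Θ_v(λ, a′, χ)` (★ `nontrivial_localCoinv_of_nontrivial_omegaAtLine`, ⊗′ structure) and the equivalence of local types (★ `nonempty_equiv_localTypes₂`, p848522).
[cite: Liu2021, Thm. 4.18 (2) p. 52 and proof l. 2270; App. D Lem. D.1 (1), (4) p. 125–126; Def. 4.12] -/
theorem locF_eq_of_equiv_carriers₂' (hw : HasWeight L lam 1) (hR : LemD1_4SameLabelNonsplitCM₂)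
    [Nontrivial (omegaAtLine (Fp L) L (IsCMField.complexConj L) 2 e₁ (Matrix.diagonal dV) (complexConj_imagUnit L) (imagUnit_ne_zero L) (imagUnit_mul_self L) (realDiagonal_isSymm L dV hdV) (isUnit_det_realDiagonal L dV hdV hdV0) (realDiagonal_map L dV hdV).symm (fun b => isCompatible_chiSplittingLine L e₁ dV hdV hdV0 (toHeckeCharacter L lam) (isUnitary_toHeckeCharacter L lam) ((isOscillatorChar_toHeckeCharacter_iff lam).mpr hlam) (TW (Fp L) b) (isSymm_TW (Fp L) b) (isUnit_det_TW (Fp L) b) (JW (Fp L) L b) (JW_eq (Fp L) L b)) a χ)]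
    (hst : ∃ f : (omegaAtLine (Fp L) L (IsCMField.complexConj L) 2 e₁ (Matrix.diagonal dV) (complexConj_imagUnit L) (imagUnit_ne_zero L) (imagUnit_mul_self L) (realDiagonal_isSymm L dV hdV) (isUnit_det_realDiagonal L dV hdV hdV0) (realDiagonal_map L dV hdV).symm (fun b => isCompatible_chiSplittingLine L e₁ dV hdV hdV0 (toHeckeCharacter L lam) (isUnitary_toHeckeCharacter L lam) ((isOscillatorChar_toHeckeCharacter_iff lam).mpr hlam) (TW (Fp L) b) (isSymm_TW (Fp L) b) (isUnit_det_TW (Fp L) b) (JW (Fp L) L b) (JW_eq (Fp L) L b)) a χ) ≃ₗ[ℂ] (omegaAtLine (Fp L) L (IsCMField.complexConj L) 2 e₁ (Matrix.diagonal dV) (complexConj_imagUnit L) (imagUnit_ne_zero L) (imagUnit_mul_self L) (realDiagonal_isSymm L dV hdV) (isUnit_det_realDiagonal L dV hdV hdV0) (realDiagonal_map L dV hdV).symm (fun b => isCompatible_chiSplittingLine L e₁ dV hdV hdV0 (toHeckeCharacter L lam) (isUnitary_toHeckeCharacter L lam) ((isOscillatorChar_toHeckeCharacter_iff lam).mpr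 hlam) (TW (Fp L) b) (isSymm_TW (Fp L) b) (isUnit_det_TW (Fp L) b) (JW (Fp L) L b) (JW_eq (Fp L) L b)) a' χ'),
      ∀ (k : finAdelic (Fp L) L (IsCMField.complexConj L) 2 (Matrix.diagonal dV)) x,
        f ((rhoVAtLine (Fp L) L (IsCMField.complexConj L) 2 e₁ (Matrix.diagonal dV) (complexConj_imagUnit L) (imagUnit_ne_zero L) (imagUnit_mul_self L) (realDiagonal_isSymm L dV hdV) (isUnit_det_realDiagonal L dV hdV hdV0) (realDiagonal_map L dV hdV).symm (fun b => isCompatible_chiSplittingLine L e₁ dV hdV hdV0 (toHeckeCharacter L lam) (isUnitary_toHeckeCharacter L lam) ((isOscillatorChar_toHeckeCharacter_iff lam).mpr hlam) (TW (Fp L) b) (isSymm_TW (Fp L) b) (isUnit_det_TW (Fp L) b) (JW (Fp L) L b) (JW_eq (Fp L) L b)) a χ) k x) = (rhoVAtLine (Fp L) L (IsCMField.complexConj L) 2 e₁ (Matrix.diagonal dV) (complexConj_imagUnit L) (imagUnit_ne_zero L) (imagUnit_mul_self L) (realDiagonal_isSymm L dV hdV) (isUnit_det_realDiagonal L dV hdV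 hdV0) (realDiagonal_map L dV hdV).symm (fun b => isCompatible_chiSplittingLine L e₁ dV hdV hdV0 (toHeckeCharacter L lam) (isUnitary_toHeckeCharacter L lam) ((isOscillatorChar_toHeckeCharacter_iff lam).mpr hlam) (TW (Fp L) b) (isSymm_TW (Fp L) b) (isUnit_det_TW (Fp L) b) (JW (Fp L) L b) (JW_eq (Fp L) L b)) a' χ') k (f x))
    (v : HeightOneSpectrum (𝓞 (Fp L))) :
    locF (Fp L) (imagUnitSq L) a v = locF (Fp L) (imagUnitSq L) a' v := by
  -- `χ′ = χ`
  have hχ : χ = χ' := chi_eq_of_equiv_carriers₂ L e₁ dV hdV hdV0 lam hlam a a' χ χ' hst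
  subst hχ
  haveI : Nontrivial (omegaAtLine (Fp L) L (IsCMField.complexConj L) 2 e₁ (Matrix.diagonal dV) (complexConj_imagUnit L) (imagUnit_ne_zero L) (imagUnit_mul_self L) (realDiagonal_isSymm L dV hdV) (isUnit_det_realDiagonal L dV hdV hdV0) (realDiagonal_map L dV hdV).symm (fun b => isCompatible_chiSplittingLine L e₁ dV hdV hdV0 (toHeckeCharacter L lam) (isUnitary_toHeckeCharacter L lam) ((isOscillatorChar_toHeckeCharacter_iff lam).mpr hlam) (TW (Fp L) b) (isSymm_TW (Fp L) b) (isUnit_det_TW (Fp L) b) (JW (Fp L) L b) (JW_eq (Fp L) L b)) a' χ) := hst.elim fun f _ => f.symm.toEquiv.nontrivial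
  haveI : NeZero n' := ⟨by have := two_le_of_finTwo_equiv e₁; omega⟩
  by_cases hsplit : ∃ w : UnitaryGroup.PlacesOver L v, IsCMField.complexConj L • (w : HeightOneSpectrum (𝓞 L)) ≠ w
  · obtain ⟨w, hw'⟩ := hsplit
    exact locF_apply_eq_of_split₂ L a a' v w hw'
  · push Not at hsplit
    exact hR L dV hdV hdV0 e₁ lam hlam hw a a' χ v hsplit (nontrivial_localCoinv_of_nontrivial_omegaAtLine L e₁ dV hdV hdV0 lam hlam a' χ v)
      (nonempty_equiv_localTypes₂ L e₁ dV hdV hdV0 lam hlam a a' χ χ v hst)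

set_option maxHeartbeats 800000 in -- the CM θ-carrier terms (not minimised)
/-- **L₂ `LineClassRigidity₂` MODULO «R₂» ONLY** (edition 2 of `lineClassRigidity₂_of_letters`: same body, the two Lem. D.1 letters replaced by
★ `LemD1_4SameLabelNonsplitCM₂`). [cite: Liu2021, Thm. 4.18 (2) p. 52; App. D Lem. D.1 (1), (4) p. 125–126; Def. 4.11, 4.12] -/
theorem lineClassRigidity₂_of_sameLabel (hR : LemD1_4SameLabelNonsplitCM₂) :
  ∀ (L : Type) [Field L] [NumberField L] [IsCMField L] (ι : L →+* ℂ) (H : Matrix (Fin 2) (Fin 2) L)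
        (dV : Fin 2 → L) (hdV : ∀ i, IsCMField.complexConj L (dV i) = dV i) (hdV0 : ∀ i, dV i ≠ 0)
        (t : L) (ht : t ≠ 0) (g : GL (Fin 2) L)
        (hg : formCongr ((IsCMField.complexConj L : L ≃ₐ[↥(maximalRealSubfield L)] L) : L →+* L) g (t • H) = Matrix.diagonal dV),
        (∃ T : GL (Fin 2) ℂ, formCongr (starRingEnd ℂ) T ((Matrix.diagonal dV).map ι) = Matrix.diagonal ![(1 : ℂ), -1]) →
        (∀ τ' : L →+* ℂ, InfinitePlace.mk τ' ≠ InfinitePlace.mk ι → ((Matrix.diagonal dV).map τ').PosDef) →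
        4 ≤ Module.finrank ℚ L →
        ∀ (𝔣 : ConeFrame L H (cmPlace L ι))
          (μ : Measure (adelicGroupData (↥(maximalRealSubfield L)) L (IsCMField.complexConj L) 2 H).automorphicQuotient)
          [(adelicGroupData (↥(maximalRealSubfield L)) L (IsCMField.complexConj L) 2 H).IsAutomorphicMeasure μ]
          {n' : ℕ} (e₁ : Fin 2 × Fin 1 ≃ Fin n')
          (lam : Literature.NumberTheory.Automorphic.IdeleClassGroup L →ₜ* Circle) (hlam : IsConjugateSymplectic L lam), HasWeight L lam 1 →
        ∀ (a a' : (↥(maximalRealSubfield L))ˣ) (χ χ' : Chi (↥(maximalRealSubfield L)) L (IsCMField.complexConj L))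
          (W : Type) [AddCommGroup W] [Module ℂ W]
          (σ : Representation ℂ (finAdelic (↥(maximalRealSubfield L)) L (IsCMField.complexConj L) 2 H) W),
          σ.IsIrreducible → σ.IsSmooth →
        ∀ j : σ.IntertwiningMap
            ((rhoVAtLine (↥(maximalRealSubfield L)) L (IsCMField.complexConj L) 2 e₁ (Matrix.diagonal dV)
                (complexConj_imagUnit L) (imagUnit_ne_zero L) (imagUnit_mul_self L) (realDiagonal_isSymm L dV hdV)
                (isUnit_det_realDiagonal L dV hdV hdV0) (realDiagonal_map L dV hdV).symm
                (fun a => isCompatible_chiSplittingLine L e₁ dV hdV hdV0 (toHeckeCharacter L lam)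
                  (isUnitary_toHeckeCharacter L lam) ((isOscillatorChar_toHeckeCharacter_iff lam).mpr hlam)
                  (TW (↥(maximalRealSubfield L)) a) (isSymm_TW (↥(maximalRealSubfield L)) a)
                  (isUnit_det_TW (↥(maximalRealSubfield L)) a) (JW (↥(maximalRealSubfield L)) L a)
                  (JW_eq (↥(maximalRealSubfield L)) L a)) a χ).comp
              (finAdelicCongr (↥(maximalRealSubfield L)) L (IsCMField.complexConj L) g ht hg).symm.toMonoidHom),
          Function.Injective j →
        ∀ j' : σ.IntertwiningMap
            ((rhoVAtLine (↥(maximalRealSubfield L)) L (IsCMField.complexConj L) 2 e₁ (Matrix.diagonal dV)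
                (complexConj_imagUnit L) (imagUnit_ne_zero L) (imagUnit_mul_self L) (realDiagonal_isSymm L dV hdV)
                (isUnit_det_realDiagonal L dV hdV hdV0) (realDiagonal_map L dV hdV).symm
                (fun a => isCompatible_chiSplittingLine L e₁ dV hdV hdV0 (toHeckeCharacter L lam)
                  (isUnitary_toHeckeCharacter L lam) ((isOscillatorChar_toHeckeCharacter_iff lam).mpr hlam)
                  (TW (↥(maximalRealSubfield L)) a) (isSymm_TW (↥(maximalRealSubfield L)) a)
                  (isUnit_det_TW (↥(maximalRealSubfield L)) a) (JW (↥(maximalRealSubfield L)) L a)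
                  (JW_eq (↥(maximalRealSubfield L)) L a)) a' χ').comp
              (finAdelicCongr (↥(maximalRealSubfield L)) L (IsCMField.complexConj L) g ht hg).symm.toMonoidHom),
          Function.Injective j' →
        ∀ v : HeightOneSpectrum (𝓞 ↥(maximalRealSubfield L)),
          locF (↥(maximalRealSubfield L)) (imagUnitSq L) a v = locF (↥(maximalRealSubfield L)) (imagUnitSq L) a' v := by
  intro L _ _ _ ι H dV hdV hdV0 t ht g hg _ _ _ 𝔣 μ _ n' e₁ lam hlam hw a a' χ χ' W _ _ σ hirr _ j hj j' hj' v
  obtain ⟨hnt, hst⟩ := exists_linearEquiv_rhoVAtLine_of_injective_pair L H dV hdV hdV0 t ht g hg e₁ lam hlam a a' χ χ' σ hirr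
    j hj j' hj'
  haveI := hnt
  exact locF_eq_of_equiv_carriers₂' L e₁ dV hdV hdV0 lam hlam a a' χ χ' hw hR hst v

end Summit.HodgeConjecture.HodgeConjecture.Cruxes.HLiu418.F0LD2SameLabelLineClass

end
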